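import Summits.HubbardSuperconductivity.HubbardSuperconductivity.Theorems.BalabanIRBirComplexStableXYRBoundedPhase
import Summits.HubbardSuperconductivity.HubbardSuperconductivity.Theorems.BalabanIRBirComplexStableXYRStubImGradientZero
import HarnessLib

/-!
# Crux `BirComplexStableXYR` (stmt-HubbardSuperconductivity-14845), line `fat-gaussian-defect-calculus`:
# stub D2 `stub_cubicRemainder` — the reduced local factor is a cubic remainder

Helper (`--supports`) for the crux
`Summit.HubbardSuperconductivity.HubbardSuperconductivity.Theses.BalabanIR.BirComplexStableXYR`, line
`fat-gaussian-defect-calculus` (lead skeleton `Cruxes/BirComplexStableXYR/Lines/fat_gaussian_defect_calculus.lean`),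
registered stub D2 `stub_cubicRemainder` (chapter 2).

**Statement.** For a finite Fourier table `c : Table r` on the window `W r` (vocabulary `Table`, `genF`,
`normA` of `Theorems.BirComplexStableXY.Negative.WitnessTable`) with (U1) charge-neutral support,
(N) `Σ_n c_n = 0`, the budget `normA c ≤ B`, the coercivity (C) `c₀ ΣΣ(1 − cos(φ_w − φ_w')) ≤ Re F(φ)`
(`c₀ > 0`) and the real-Hessian hypothesis (I3) `Σ_n Im(c_n)(n·v)² = 0`, and with
`Q(u) = Re(−Σ_n c_n (n·u)²)`, `m_w = Σ_n Re(c_n) n_w`, every window configuration `u` of oscillation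
`≤ δ` satisfies `‖genF c u − i·(m·u) − Q(u)/2‖ ≤ 2·B·δ³`.

**Proof.** The landed cubic Taylor bound `cvxr_norm_genF_sub_taylor2_le` (`…RBoundedPhase`) gives
`‖genF c u − T₂(u)‖ ≤ 2·normA(c)·δ³ ≤ 2Bδ³` with `T₂(u) = Σ_n c_n (i(n·u) − (n·u)²/2)`.  It remains to
identify `T₂(u) = i·(m·u) + Q(u)/2`: the linear part `Σ_n c_n (n·u)` is real and equals `m·u` because
its imaginary part `Σ_w u_w Σ_n Im(c_n) n_w` vanishes by the landed stub C7 `stub_imGradientZero`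
(first-order condition at the minimum of `Re F`), and the quadratic part `−½ Σ_n c_n (n·u)²` is real and
equals `Q(u)/2` because its imaginary part is `−½ · (I3 at v = u) = 0`.  No definitions; sorry-free;
everything else is Mathlib. [folklore]
-/

set_option linter.dupNamespace false -- `Summit.<S>.<S>.Theorems…` repeats the summit name (D-0017 layout)

noncomputable section

namespace Summit.HubbardSuperconductivity.HubbardSuperconductivity.Theorems.FSUnfolding

open scoped BigOperators
open Literature.Probability.LatticeModels Summit.HubbardSuperconductivity.BirComplexStableXYNegative

/-- Real part of the linear Taylor coefficient, resummed over window sites: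
`Σ_n Re(c_n) (n·u) = Σ_w m_w u_w` with `m_w = Σ_n Re(c_n) n_w` (exchange of two finite sums). [folklore] -/
theorem cubicRem_linear_re {r : ℕ} (c : Table r) (m : W r → ℝ)
    (hm : ∀ w : W r, m w = c.sum (fun n a => a.re * (n w : ℝ))) (u : W r → ℝ) :
    (∑ n ∈ c.support, (c n).re * (∑ w, (n w : ℝ) * u w)) = ∑ w, m w * u w := by
  have h : ∀ w, m w * u w = ∑ n ∈ c.support, (c n).re * (n w : ℝ) * u w := by
    intro w
    rw [hm w]
    unfold Finsupp.sum
    rw [Finset.sum_mul]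
  simp_rw [h]
  rw [Finset.sum_comm]
  refine Finset.sum_congr rfl fun n _ => ?_
  rw [Finset.mul_sum]
  refine Finset.sum_congr rfl fun w _ => ?_
  ring

/-- Imaginary part of the linear Taylor coefficient vanishes once the imaginary gradient does:
`Σ_n Im(c_n) (n·u) = Σ_w u_w · (Σ_n Im(c_n) n_w) = 0` (the inner sums vanish by stub C7). [folklore] -/
theorem cubicRem_linear_im {r : ℕ} (c : Table r)
    (hgrad : ∀ w : W r, c.sum (fun n a => a.im * (n w : ℝ)) = 0) (u : W r → ℝ) :
    (∑ n ∈ c.support, (c n).im * (∑ w, (n w : ℝ) * u w)) = 0 := by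
  have h : (∑ n ∈ c.support, (c n).im * (∑ w, (n w : ℝ) * u w)) =
      ∑ w, (c.sum (fun n a => a.im * (n w : ℝ))) * u w := by
    unfold Finsupp.sum
    simp_rw [Finset.sum_mul, Finset.mul_sum]
    rw [Finset.sum_comm]
    refine Finset.sum_congr rfl fun w _ => Finset.sum_congr rfl fun n _ => ?_
    ring
  rw [h]
  exact Finset.sum_eq_zero fun w _ => by rw [hgrad w, zero_mul]

/-- The linear Taylor coefficient is the real pairing with the real gradient:
`Σ_n c_n (n·u) = m·u` (as complex numbers), given `m_w = Σ_n Re(c_n) n_w` and the vanishing of the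
imaginary gradient `Σ_n Im(c_n) n_w = 0` (stub C7). [folklore] -/
theorem cubicRem_linear {r : ℕ} (c : Table r) (m : W r → ℝ)
    (hm : ∀ w : W r, m w = c.sum (fun n a => a.re * (n w : ℝ)))
    (hgrad : ∀ w : W r, c.sum (fun n a => a.im * (n w : ℝ)) = 0) (u : W r → ℝ) :
    (∑ n ∈ c.support, c n * ((∑ w, (n w : ℝ) * u w : ℝ) : ℂ)) = ((∑ w, m w * u w : ℝ) : ℂ) := by
  apply Complex.ext
  · rw [Complex.re_sum, Complex.ofReal_re, ← cubicRem_linear_re c m hm u]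
    exact Finset.sum_congr rfl fun n _ => Complex.re_mul_ofReal _ _
  · rw [Complex.im_sum, Complex.ofReal_im, ← cubicRem_linear_im c hgrad u]
    exact Finset.sum_congr rfl fun n _ => Complex.im_mul_ofReal _ _

/-- The quadratic Taylor coefficient is real: `Σ_n c_n (n·u)²/2 = −Q(u)/2` (as complex numbers), given
`Q(u) = Re(−Σ_n c_n (n·u)²)` and the real-Hessian hypothesis (I3) `Σ_n Im(c_n)(n·v)² = 0` at `v = u`.
[folklore] -/
theorem cubicRem_quadratic {r : ℕ} (c : Table r) (Q : (W r → ℝ) → ℝ)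
    (hQ : ∀ u : W r → ℝ, Q u = (-c.sum (fun n a => a * (((∑ w, (n w : ℝ) * u w) ^ 2 : ℝ) : ℂ))).re)
    (hI3 : ∀ v : W r → ℝ, c.sum (fun n a => a.im * (∑ w, (n w : ℝ) * v w) ^ 2) = 0)
    (u : W r → ℝ) :
    (∑ n ∈ c.support, c n * ((((∑ w, (n w : ℝ) * u w) ^ 2 / 2 : ℝ)) : ℂ)) = -(((Q u / 2 : ℝ)) : ℂ) := by
  apply Complex.ext
  · rw [Complex.re_sum, Complex.neg_re, Complex.ofReal_re, hQ u]
    unfold Finsupp.sum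
    rw [Complex.neg_re, Complex.re_sum, neg_div, neg_neg, Finset.sum_div]
    refine Finset.sum_congr rfl fun n _ => ?_
    rw [Complex.re_mul_ofReal, Complex.re_mul_ofReal]
    ring
  · rw [Complex.im_sum, Complex.neg_im, Complex.ofReal_im, neg_zero]
    have h3 := hI3 u
    unfold Finsupp.sum at h3
    calc (∑ n ∈ c.support, (c n * ((((∑ w, (n w : ℝ) * u w) ^ 2 / 2 : ℝ)) : ℂ)).im)
        = (∑ n ∈ c.support, (c n).im * (∑ w, (n w : ℝ) * u w) ^ 2) / 2 := by
          rw [Finset.sum_div]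
          refine Finset.sum_congr rfl fun n _ => ?_
          rw [Complex.im_mul_ofReal]
          ring
      _ = 0 := by rw [h3, zero_div]

/-- The quadratic Taylor polynomial of `genF c` at the constants, split into its Berry phase and its
real quadratic part: `Σ_n c_n (i(n·u) − (n·u)²/2) = i·(m·u) + Q(u)/2`, given `m_w = Σ_n Re(c_n) n_w`,
the vanishing imaginary gradient (stub C7), `Q(u) = Re(−Σ_n c_n (n·u)²)` and (I3). [folklore] -/
theorem cubicRem_taylor2_eq {r : ℕ} (c : Table r) (Q : (W r → ℝ) → ℝ)
    (hQ : ∀ u : W r → ℝ, Q u = (-c.sum (fun n a => a * (((∑ w, (n w : ℝ) * u w) ^ 2 : ℝ) : ℂ))).re)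
    (hI3 : ∀ v : W r → ℝ, c.sum (fun n a => a.im * (∑ w, (n w : ℝ) * v w) ^ 2) = 0)
    (m : W r → ℝ) (hm : ∀ w : W r, m w = c.sum (fun n a => a.re * (n w : ℝ)))
    (hgrad : ∀ w : W r, c.sum (fun n a => a.im * (n w : ℝ)) = 0) (u : W r → ℝ) :
    c.sum (fun n a => a * (Complex.I * ((∑ w, (n w : ℝ) * u w : ℝ) : ℂ) -
        (((∑ w, (n w : ℝ) * u w) ^ 2 / 2 : ℝ) : ℂ))) =
      Complex.I * ((∑ w : W r, m w * u w : ℝ) : ℂ) + (((Q u / 2) : ℝ) : ℂ) := by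
  unfold Finsupp.sum
  have hsplit : ∀ n ∈ c.support,
      c n * (Complex.I * ((∑ w, (n w : ℝ) * u w : ℝ) : ℂ) -
        (((∑ w, (n w : ℝ) * u w) ^ 2 / 2 : ℝ) : ℂ)) =
      Complex.I * (c n * ((∑ w, (n w : ℝ) * u w : ℝ) : ℂ)) -
        c n * (((∑ w, (n w : ℝ) * u w) ^ 2 / 2 : ℝ) : ℂ) := fun n _ => by ring
  rw [Finset.sum_congr rfl hsplit, Finset.sum_sub_distrib, ← Finset.mul_sum,
    cubicRem_linear c m hm hgrad u, cubicRem_quadratic c Q hQ hI3 u, sub_neg_eq_add]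

/-- **Registered stub D2 `stub_cubicRemainder` (verbatim signature): the reduced local factor is a cubic
remainder.**  Under (U1), (N), (C) (so `Σ_n Im(c_n) n = 0`, `stub_imGradientZero`), the real-Hessian
hypothesis (I3) and the budget `normA c ≤ B`, the window weight is its Berry phase plus its real
quadratic part up to a cubic error controlled by the window oscillation:
`‖genF c u − i·m·u − ½Q(u)‖ ≤ 2B·δ³` whenever `|u_w − u_w'| ≤ δ` (`m_w = Σ_n Re(c_n)n_w`; the landed
Taylor bound `cvxr_norm_genF_sub_taylor2_le` and the identification `cubicRem_taylor2_eq` of the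
quadratic Taylor polynomial). [folklore] -/
theorem stub_cubicRemainder :
    ∀ (r : ℕ) (B c₀ : ℝ) (c : Table r), 0 < c₀ → (∀ n ∈ c.support, ∑ w, n w = 0) → c.sum (fun _ a => a) = 0 →
      normA c ≤ B → (∀ φ : W r → ℝ, c₀ * ∑ w, ∑ w', (1 - Real.cos (φ w - φ w')) ≤ (genF c φ).re) →
      (∀ v : W r → ℝ, c.sum (fun n a => a.im * (∑ w, (n w : ℝ) * v w) ^ 2) = 0) →
      ∀ (Q : (W r → ℝ) → ℝ),
      (∀ u : W r → ℝ, Q u = (-c.sum (fun n a => a * (((∑ w, (n w : ℝ) * u w) ^ 2 : ℝ) : ℂ))).re) →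
      ∀ (m : W r → ℝ), (∀ w : W r, m w = c.sum (fun n a => a.re * (n w : ℝ))) →
      ∀ (u : W r → ℝ) (δ : ℝ), 0 ≤ δ → (∀ w w' : W r, |u w - u w'| ≤ δ) →
        ‖genF c u - Complex.I * ((∑ w : W r, m w * u w : ℝ) : ℂ) - (((Q u / 2) : ℝ) : ℂ)‖ ≤ 2 * B * δ ^ 3 := by
  intro r B c₀ c hc₀ hU1 hN hB hC hI3 Q hQ m hm u δ hδ hu
  have hgrad : ∀ w : W r, c.sum (fun n a => a.im * (n w : ℝ)) = 0 :=
    stub_imGradientZero r c c₀ hc₀ hN hC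
  have h := cvxr_norm_genF_sub_taylor2_le c hU1 hN u hδ hu
  have hT := cubicRem_taylor2_eq c Q hQ hI3 m hm hgrad u
  have hδ3 : 0 ≤ δ ^ 3 := pow_nonneg hδ 3
  calc ‖genF c u - Complex.I * ((∑ w : W r, m w * u w : ℝ) : ℂ) - (((Q u / 2) : ℝ) : ℂ)‖
      = ‖genF c u - c.sum (fun n a => a * (Complex.I * ((∑ w, (n w : ℝ) * u w : ℝ) : ℂ) -
          (((∑ w, (n w : ℝ) * u w) ^ 2 / 2 : ℝ) : ℂ)))‖ := by rw [hT, sub_sub]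
    _ ≤ 2 * normA c * δ ^ 3 := h
    _ ≤ 2 * B * δ ^ 3 := by
        have hmul : normA c * δ ^ 3 ≤ B * δ ^ 3 := mul_le_mul_of_nonneg_right hB hδ3
        linarith

end Summit.HubbardSuperconductivity.HubbardSuperconductivity.Theorems.FSUnfolding

end
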